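import Summits.QuantumFields.QCD.Theorems.NestedDissectionSeaCoerciveSeaStieltjesReduction

/-!
# Crux `CoerciveSea` (stmt-QuantumFields-13901), line `chirality-collapses-pseudospectrum`, stub A″ —
# the SPLIT Stieltjes reduction (lead c2): the (b)-alternative keeps its share of the pile-up

Refines lead-1's `chiralPileup_stieltjes_trichotomy` (p102028). There, ONE member meeting a directed-non-chiral
window vector sends the whole A″ family to alternative (b) — but on window-top cells the massive sea supplies such
members typically (finding of lead c2, `FINDINGS-lead-c2.md`: massive Dirac modes have chirality `m/E`, their
branches bend instead of crossing), so (b) as an EVENT is typical and useless in a union bound. Here the members are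
PARTITIONED by the four-sign theorem's alternative and the pile-up `Σ_j wgt_j f_j > 1/(4τ)` is split by pigeonhole:
either the (b)-members alone pile up `> 1/(8τ)` (a RARE event again: sea members contribute `o(1)` of the threshold),
or the crossing members alone carry a Stieltjes pile-up `> 1/(8τ)`. Deterministic. [folklore]
-/

noncomputable section

open scoped BigOperators ComplexConjugate
open Matrix Literature.MathematicalPhysics.QuantumLattice Literature.MathematicalPhysics.QuantumFieldTheory
  Literature.Probability.LatticeModels

namespace Summit.QuantumFields.QCD.Cruxes.CoerciveSea.ChiralityCollapsesPseudospectrum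

namespace ChiralForcesCrossing

/-- **Split Stieltjes reduction of the chiral pile-up.** For a family of normalised pencil eigenvectors `u_j` of
`wilsonCell U μ 0 s` (`D_c u_j = ev_j Γ_c u_j`) with `|ev_j| < 2τ`, weights `0 ≤ wgt_j`, `wgt_j|ev_j| ≤ 1`, and
sheet-weighted pile-up `Σ_j wgt_j f(u_j) > 1/(4τ)` (`f(u) = Σ_{p ∉ childrenInterior s} ‖u_p‖²`), and a cut `0 < χ₀ ≤ 1`:
(a) `det D_c(μ) = 0`; or (b) a finite set `B` of members, EACH meeting a directed-non-chiral window vector within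
`|ev_j|/χ₀` of the mass (same data as in `chiralPileup_stieltjes_trichotomy`), whose OWN pile-up exceeds `1/(8τ)`;
or (c) a finite set `C` of members with one crossing each, `det D_c(μ*_j) = 0`, `0 < |μ*_j − μ| ≤ |ev_j|/χ₀`, whose
Stieltjes pile-up `Σ_{j ∈ C} f(u_j)/(χ₀|μ*_j − μ|)` exceeds `1/(8τ)`. [folklore] -/
theorem chiralPileup_stieltjes_split :
    ∀ (N : ℕ) [NeZero N] (U : GaugeConfig 4 N (Matrix.specialUnitaryGroup (Fin 3) ℂ))
      (s : Fin 4 → ℕ) (μ τ χ₀ : ℝ) (n : ℕ) (u : Fin n → ({p // wilsonBox (0 : TorusSite 4 N) s p} → ℂ))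
      (ev wgt : Fin n → ℝ), 0 < τ → 0 < χ₀ → χ₀ ≤ 1 →
      (∀ j, ∑ p, star (u j p) * u j p = 1) →
      (∀ j, (wilsonCell U μ 0 s).mulVec (u j) = fun p => (ev j : ℂ) * gammaFive p.1.2.2 p.1.2.2 * u j p) →
      (∀ j, |ev j| < 2 * τ ∧ 0 ≤ wgt j ∧ wgt j * |ev j| ≤ 1) →
      1 / (4 * τ) < ∑ j, wgt j * ∑ p, (if childrenInterior s p then (0 : ℝ) else ‖u j p‖ ^ 2) →
      (wilsonCell U μ 0 s).det = 0 ∨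
      (∃ B : Finset (Fin n),
        (∀ j ∈ B, ∃ μ' : ℝ, |μ' - μ| ≤ |ev j| / χ₀ ∧ ∃ σ : ℝ, (σ = 1 ∨ σ = -1) ∧
          0 ≤ σ * (∑ p, star (u j p) * gammaFive p.1.2.2 p.1.2.2 * u j p).re ∧
          ∃ v : {p // wilsonBox (0 : TorusSite 4 N) s p} → ℂ, v ≠ 0 ∧ ∃ c : ℝ,
            ((wilsonCell U μ' 0 s).mulVec v = fun p => (c : ℂ) * gammaFive p.1.2.2 p.1.2.2 * v p) ∧
            0 < c * ev j ∧ |c| ≤ |ev j| ∧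
            σ * (∑ p, star (v p) * gammaFive p.1.2.2 p.1.2.2 * v p).re < χ₀ * ∑ p, ‖v p‖ ^ 2) ∧
        1 / (8 * τ) < ∑ j ∈ B, wgt j * ∑ p, (if childrenInterior s p then (0 : ℝ) else ‖u j p‖ ^ 2)) ∨
      (∃ C : Finset (Fin n), ∃ μs : Fin n → ℝ,
        (∀ j ∈ C, (wilsonCell U (μs j) 0 s).det = 0 ∧ 0 < |μs j - μ| ∧ |μs j - μ| ≤ |ev j| / χ₀) ∧
        1 / (8 * τ) < ∑ j ∈ C, (∑ p, (if childrenInterior s p then (0 : ℝ) else ‖u j p‖ ^ 2)) /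
          (χ₀ * |μs j - μ|)) := by
  intro N _ U s μ τ χ₀ n u ev wgt hτ hχ₀ hχ₁ hunit heig hbd hpile
  classical
  by_cases hdet : (wilsonCell U μ 0 s).det = 0
  · exact Or.inl hdet
  right
  have hu0 : ∀ j, u j ≠ 0 := fun j => ne_zero_of_sum_star_mul_self_eq_one (hunit j)
  -- every member has `ev_j ≠ 0` (else the cell crosses at `μ`)
  have hev0 : ∀ j, ev j ≠ 0 := by
    intro j hj
    refine hdet (det_wilsonCell_eq_zero_of_ev_zero U μ s (u j) (hu0 j) ?_)
    rw [heig j, hj]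
  -- directions per member
  set σ : Fin n → ℝ := fun j =>
    if 0 ≤ (∑ p, star (u j p) * gammaFive p.1.2.2 p.1.2.2 * u j p).re then 1 else -1 with hσdef
  set τs : Fin n → ℝ := fun j => if 0 ≤ ev j then 1 else -1 with hτsdef
  have hσ : ∀ j, σ j = 1 ∨ σ j = -1 := fun j => by
    simp only [hσdef]; split_ifs <;> simp
  have hσnn : ∀ j, 0 ≤ σ j * (∑ p, star (u j p) * gammaFive p.1.2.2 p.1.2.2 * u j p).re := fun j => by
    simp only [hσdef]
    split_ifs with h
    · simpa using h
    · push Not at h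
      nlinarith
  have hτs : ∀ j, τs j = 1 ∨ τs j = -1 := fun j => by
    simp only [hτsdef]; split_ifs <;> simp
  have hτev : ∀ j, 0 < τs j * ev j := fun j => by
    simp only [hτsdef]
    split_ifs with h
    · have := lt_of_le_of_ne h (Ne.symm (hev0 j)); simpa using this
    · push Not at h; nlinarith
  have habs : ∀ j, τs j * ev j = |ev j| := fun j => by
    simp only [hτsdef]
    split_ifs with h
    · rw [one_mul, abs_of_nonneg h]
    · push Not at h; rw [neg_one_mul, abs_of_neg h]
  have hστ1 : ∀ j, |σ j * τs j| = 1 := fun j => by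
    rcases hσ j with h | h <;> rcases hτs j with h' | h' <;> rw [h, h'] <;> norm_num
  -- the four-sign theorem, member by member
  have key : ∀ j, ∃ x : ℝ, 0 ≤ x ∧ x ≤ |ev j| / χ₀ ∧
      ((wilsonCell U (μ - σ j * τs j * x) 0 s).det = 0 ∨
        ∃ v : {p // wilsonBox (0 : TorusSite 4 N) s p} → ℂ, v ≠ 0 ∧ ∃ c : ℝ,
          ((wilsonCell U (μ - σ j * τs j * x) 0 s).mulVec v =
              fun p => (c : ℂ) * gammaFive p.1.2.2 p.1.2.2 * v p) ∧
          0 < τs j * c ∧ τs j * c ≤ τs j * ev j ∧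
          σ j * (∑ p, star (v p) * gammaFive p.1.2.2 p.1.2.2 * v p).re < χ₀ * ∑ p, ‖v p‖ ^ 2) := by
    intro j
    obtain ⟨x, hx0, hx1, halt⟩ := chiral_member_forces_crossing_or_nonchiral N U s μ (u j) (ev j) χ₀ (σ j)
      (τs j) (hu0 j) (heig j) hχ₀ hχ₁ (hσ j) (hτs j) (hτev j)
    refine ⟨x, hx0, ?_, halt⟩
    rwa [habs j] at hx1
  -- partition of the members: `C` = those forcing a crossing strictly off the mass, `B` = the rest
  set C : Finset (Fin n) := Finset.univ.filter fun j => ∃ x : ℝ, 0 < x ∧ x ≤ |ev j| / χ₀ ∧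
      (wilsonCell U (μ - σ j * τs j * x) 0 s).det = 0 with hCdef
  set B : Finset (Fin n) := Finset.univ.filter fun j => ¬ ∃ x : ℝ, 0 < x ∧ x ≤ |ev j| / χ₀ ∧
      (wilsonCell U (μ - σ j * τs j * x) 0 s).det = 0 with hBdef
  have hsplit : ∑ j ∈ C, wgt j * ∑ p, (if childrenInterior s p then (0 : ℝ) else ‖u j p‖ ^ 2) +
      ∑ j ∈ B, wgt j * ∑ p, (if childrenInterior s p then (0 : ℝ) else ‖u j p‖ ^ 2) =
      ∑ j, wgt j * ∑ p, (if childrenInterior s p then (0 : ℝ) else ‖u j p‖ ^ 2) :=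
    Finset.sum_filter_add_sum_filter_not _ _ _
  -- members of `B` meet a directed-non-chiral window vector
  have hBdata : ∀ j, j ∈ B → ∃ μ' : ℝ, |μ' - μ| ≤ |ev j| / χ₀ ∧ ∃ σ : ℝ, (σ = 1 ∨ σ = -1) ∧
      0 ≤ σ * (∑ p, star (u j p) * gammaFive p.1.2.2 p.1.2.2 * u j p).re ∧
      ∃ v : {p // wilsonBox (0 : TorusSite 4 N) s p} → ℂ, v ≠ 0 ∧ ∃ c : ℝ,
        ((wilsonCell U μ' 0 s).mulVec v = fun p => (c : ℂ) * gammaFive p.1.2.2 p.1.2.2 * v p) ∧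
        0 < c * ev j ∧ |c| ≤ |ev j| ∧
        σ * (∑ p, star (v p) * gammaFive p.1.2.2 p.1.2.2 * v p).re < χ₀ * ∑ p, ‖v p‖ ^ 2 := by
    intro j hj
    have hjC : ¬ ∃ x : ℝ, 0 < x ∧ x ≤ |ev j| / χ₀ ∧
        (wilsonCell U (μ - σ j * τs j * x) 0 s).det = 0 := by
      rw [hBdef, Finset.mem_filter] at hj
      exact hj.2
    obtain ⟨x, hx0, hx1, halt⟩ := key j
    rcases halt with hd | ⟨v, hv0, c, hv, hc1, hc2, hform⟩
    · exfalso
      rcases hx0.eq_or_lt with h0 | hpos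
      · rw [← h0, mul_zero, sub_zero] at hd
        exact hdet hd
      · exact hjC ⟨x, hpos, hx1, hd⟩
    · refine ⟨μ - σ j * τs j * x, ?_, σ j, hσ j, hσnn j, v, hv0, c, hv, ?_, ?_, hform⟩
      · have : μ - σ j * τs j * x - μ = -(σ j * τs j * x) := by ring
        rw [this, abs_neg, abs_mul, hστ1 j, one_mul, abs_of_nonneg hx0]
        exact hx1
      · have hτ2 : τs j * τs j = 1 := by rcases hτs j with h | h <;> rw [h] <;> norm_num
        nlinarith [hτev j]
      · have hcabs : |c| = τs j * c := by
          rcases hτs j with h | h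
          · rw [h, one_mul] at hc1 ⊢; exact abs_of_pos hc1
          · rw [h, neg_one_mul] at hc1 ⊢; exact abs_of_neg (by linarith)
        rw [hcabs, ← habs j]
        exact hc2
  -- pigeonhole on the pile-up `Σ_univ = Σ_C + Σ_B > 1/(4τ) = 1/(8τ) + 1/(8τ)`
  by_cases hBpile :
      1 / (8 * τ) < ∑ j ∈ B, wgt j * ∑ p, (if childrenInterior s p then (0 : ℝ) else ‖u j p‖ ^ 2)
  · left
    exact ⟨B, fun j hj => hBdata j hj, hBpile⟩
  right
  have hCpile :
      1 / (8 * τ) < ∑ j ∈ C, wgt j * ∑ p, (if childrenInterior s p then (0 : ℝ) else ‖u j p‖ ^ 2) := by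
    have h8 : 1 / (4 * τ) = 1 / (8 * τ) + 1 / (8 * τ) := by ring
    linarith [hsplit, hpile, not_lt.1 hBpile]
  -- one crossing per member of `C`
  have hC' : ∀ j, ∃ x : ℝ, j ∈ C → (0 < x ∧ x ≤ |ev j| / χ₀ ∧
      (wilsonCell U (μ - σ j * τs j * x) 0 s).det = 0) := by
    intro j
    by_cases hj : j ∈ C
    · have hj' := hj
      rw [hCdef, Finset.mem_filter] at hj'
      obtain ⟨x, hx⟩ := hj'.2
      exact ⟨x, fun _ => hx⟩
    · exact ⟨0, fun h => absurd h hj⟩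
  choose x hx using hC'
  have hdist : ∀ j, j ∈ C → |μ - σ j * τs j * x j - μ| = x j := fun j hj => by
    have : μ - σ j * τs j * x j - μ = -(σ j * τs j * x j) := by ring
    rw [this, abs_neg, abs_mul, hστ1, one_mul, abs_of_pos (hx j hj).1]
  refine ⟨C, fun j => μ - σ j * τs j * x j, fun j hj => ⟨(hx j hj).2.2, ?_, ?_⟩, ?_⟩
  · rw [hdist j hj]; exact (hx j hj).1
  · rw [hdist j hj]; exact (hx j hj).2.1
  · refine lt_of_lt_of_le hCpile (Finset.sum_le_sum fun j hj => ?_)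
    obtain ⟨hxpos, hxle, -⟩ := hx j hj
    rw [hdist j hj]
    have hf : 0 ≤ ∑ p, (if childrenInterior s p then (0 : ℝ) else ‖u j p‖ ^ 2) :=
      Finset.sum_nonneg fun p _ => by split_ifs <;> positivity
    -- `wgt_j ≤ 1/|ev_j| ≤ 1/(χ₀ x_j)`
    have hevpos : 0 < |ev j| := abs_pos.2 (hev0 j)
    have hw : wgt j ≤ 1 / (χ₀ * x j) := by
      have h1 : wgt j ≤ 1 / |ev j| := by
        rw [le_div_iff₀ hevpos]; exact (hbd j).2.2
      have h2 : χ₀ * x j ≤ |ev j| := by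
        have := hxle
        rwa [le_div_iff₀ hχ₀, mul_comm] at this
      have h3 : 1 / |ev j| ≤ 1 / (χ₀ * x j) :=
        one_div_le_one_div_of_le (mul_pos hχ₀ hxpos) h2
      exact h1.trans h3
    rw [div_eq_mul_one_div, mul_comm _ (1 / (χ₀ * x j))]
    exact mul_le_mul_of_nonneg_right hw hf

end ChiralForcesCrossing

end Summit.QuantumFields.QCD.Cruxes.CoerciveSea.ChiralityCollapsesPseudospectrum

end
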